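import Mathlib
import HarnessLib
import Literature.Analysis.FluidPDE.TypeIAncientMild
import Summits.NavierStokesRegularity.NavierStokesRegularity.Theorems.ExtremalTypeIConstantExtremalSpiralSymmetryBlowDownCalculus
import Summits.NavierStokesRegularity.NavierStokesRegularity.Theorems.PoloidalWindowDoorPoloidalWindowRigidityPoloidalExtremal

/-!
# Route `PoloidalWindowDoor`, crux `PoloidalWindowRigidity` (K2, stmt-NavierStokesRegularity-19708) —
# a SELF-RECURRENT extremal poloidal profile (normal form for the residue S2′, part 4: Birkhoff recurrence)

Cell ns-regularity-ideate, K2 lead ns-poloidal-K2-p1 (support file, `--supports stmt-…-19708 --as helper`; task (H1d); companions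
`…PoloidalExtremal` (p469616), `…PoloidalExtremalFarPast` (p470378), `…PoloidalExtremalBlowDown` (p470559)).

Route `ExtremalTypeIConstant`'s Birkhoff/Zorn argument (`exists_selfBlowDown_of_forall_exists_blowDown`: minimal closed subset of the
compact image of the extremal set under evaluation on a dense sequence, invariant under the blow-down relation) run INSIDE the poloidal
frozen sub-class, whose extremal set is sequentially compact with the normalisation AND the poloidal/frozen constraints preserved (KNSS
limits converge gradients, `poloidal_of_tendsto` / `frozen_of_tendsto`):

* `exists_selfBlowDown_poloidal` — if 𝓔_pol(C) = {W ∈ 𝔓(C) poloidal, frozen, ‖W(−1,0)‖ = C} is nonempty and every element has a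
  blow-down in 𝓔_pol(C), then some element is a blow-down of ITSELF;
* COROLLARY (one line from `…PoloidalExtremal.exists_poloidal_extremal` + `…PoloidalExtremalBlowDown.poloidal_extremal_blowDown_extremal`
  (p470559) + this theorem; to be filed separately once that module is built on the farm): if some poloidal frozen Type-I profile is
  nontrivial, there is an extremal poloidal frozen `W` with `λ_j W(λ_j² t, x_j + λ_j x) → W(t,x)` on the slab for some `λ_j → ∞` —
  THE RESIDUE PROVER MAY WORK WLOG WITH A POLOIDAL PROFILE THAT IS EXTREMAL (hot spot at (−1,0)) AND RECURRENT UNDER BLOW-DOWN.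

WHAT THIS IS NOT: not a claim about Navier–Stokes regularity and not the residue — a normal form (compactness + symmetry + Zorn, no new
mechanism), bears_on LADDER-NS N0, rung N0-LocalTubeDoorPoloidal.
-/

noncomputable section

-- the summit and its single sub-problem share the name (CONVENTIONS §1), as in every Theorems file
set_option linter.dupNamespace false

namespace Summit.NavierStokesRegularity.NavierStokesRegularity.Theorems.PoloidalWindowDoorPoloidalWindowRigidityPoloidalExtremalRecurrent

open MeasureTheory Set Function Filter Topology
open scoped RealInnerProductSpace InnerProductSpace
open Literature.Analysis Literature.Analysis.FluidPDE
open Summit.NavierStokesRegularity.NavierStokesRegularity.Theorems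
open Summit.NavierStokesRegularity.NavierStokesRegularity.Theorems.ExtremalSpiralSymmetry.Registered
open Summit.NavierStokesRegularity.NavierStokesRegularity.Theorems.PoloidalWindowDoorPoloidalWindowRigidityPoloidalExtremal

/-- **Birkhoff recurrence for blow-downs inside the poloidal sub-class (core).** If the set
`𝓔_pol(C) = {W ∈ 𝔓(C) : poloidal, frozen, ‖W(−1,0)‖ = C}` is nonempty and every element has a blow-down in `𝓔_pol(C)`, then some
`W ∈ 𝓔_pol(C)` is a blow-down of itself. -/
theorem exists_selfBlowDown_poloidal {C : ℝ}
    (hne : ∃ W : ℝ → EuclideanSpace ℝ (Fin 3) → EuclideanSpace ℝ (Fin 3),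
      IsTypeIAncientMild C W ∧ (∀ s < 0, ∀ y, ⟪curl (W s) y, EuclideanSpace.single 2 (1 : ℝ)⟫_ℝ = 0) ∧
        (∀ s < 0, ∀ y, ⟪fderiv ℝ (W s) y (curl (W s) y), EuclideanSpace.single 2 (1 : ℝ)⟫_ℝ = 0) ∧ ‖W (-1) 0‖ = C)
    (hbd : ∀ W : ℝ → EuclideanSpace ℝ (Fin 3) → EuclideanSpace ℝ (Fin 3),
      IsTypeIAncientMild C W → (∀ s < 0, ∀ y, ⟪curl (W s) y, EuclideanSpace.single 2 (1 : ℝ)⟫_ℝ = 0) →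
        (∀ s < 0, ∀ y, ⟪fderiv ℝ (W s) y (curl (W s) y), EuclideanSpace.single 2 (1 : ℝ)⟫_ℝ = 0) → ‖W (-1) 0‖ = C →
      ∃ W' : ℝ → EuclideanSpace ℝ (Fin 3) → EuclideanSpace ℝ (Fin 3),
        IsTypeIAncientMild C W' ∧ (∀ s < 0, ∀ y, ⟪curl (W' s) y, EuclideanSpace.single 2 (1 : ℝ)⟫_ℝ = 0) ∧
          (∀ s < 0, ∀ y, ⟪fderiv ℝ (W' s) y (curl (W' s) y), EuclideanSpace.single 2 (1 : ℝ)⟫_ℝ = 0) ∧ ‖W' (-1) 0‖ = C ∧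
        ∃ (lam : ℕ → ℝ) (xs : ℕ → EuclideanSpace ℝ (Fin 3)), (∀ j, 0 < lam j) ∧ Tendsto lam atTop atTop ∧
          ∀ t < (0 : ℝ), ∀ x, Tendsto (fun j => lam j • W (lam j ^ 2 * t) (xs j + lam j • x)) atTop
            (𝓝 (W' t x))) :
    ∃ W : ℝ → EuclideanSpace ℝ (Fin 3) → EuclideanSpace ℝ (Fin 3),
      IsTypeIAncientMild C W ∧ (∀ s < 0, ∀ y, ⟪curl (W s) y, EuclideanSpace.single 2 (1 : ℝ)⟫_ℝ = 0) ∧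
        (∀ s < 0, ∀ y, ⟪fderiv ℝ (W s) y (curl (W s) y), EuclideanSpace.single 2 (1 : ℝ)⟫_ℝ = 0) ∧ ‖W (-1) 0‖ = C ∧
      ∃ (lam : ℕ → ℝ) (xs : ℕ → EuclideanSpace ℝ (Fin 3)), (∀ j, 0 < lam j) ∧ Tendsto lam atTop atTop ∧
        ∀ t < (0 : ℝ), ∀ x, Tendsto (fun j => lam j • W (lam j ^ 2 * t) (xs j + lam j • x)) atTop
          (𝓝 (W t x)) := by
  obtain ⟨q, hq, hqd⟩ := exists_dense_seq_slab
  -- the set `𝓔`, the evaluation map `ι` and its image `S`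
  set E : Set (ℝ → EuclideanSpace ℝ (Fin 3) → EuclideanSpace ℝ (Fin 3)) :=
    {W | IsTypeIAncientMild C W ∧ (∀ s < 0, ∀ y, ⟪curl (W s) y, EuclideanSpace.single 2 (1 : ℝ)⟫_ℝ = 0) ∧
      (∀ s < 0, ∀ y, ⟪fderiv ℝ (W s) y (curl (W s) y), EuclideanSpace.single 2 (1 : ℝ)⟫_ℝ = 0) ∧ ‖W (-1) 0‖ = C} with hE
  set ι : (ℝ → EuclideanSpace ℝ (Fin 3) → EuclideanSpace ℝ (Fin 3)) → (ℕ → EuclideanSpace ℝ (Fin 3)) :=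
    fun W n => W (q n).1 (q n).2 with hι
  set S : Set (ℕ → EuclideanSpace ℝ (Fin 3)) := ι '' E with hS
  -- the blow-down relation, as a predicate
  set BD : (ℝ → EuclideanSpace ℝ (Fin 3) → EuclideanSpace ℝ (Fin 3)) →
      (ℝ → EuclideanSpace ℝ (Fin 3) → EuclideanSpace ℝ (Fin 3)) → Prop :=
    fun W W' => ∃ (lam : ℕ → ℝ) (xs : ℕ → EuclideanSpace ℝ (Fin 3)), (∀ j, 0 < lam j) ∧
      Tendsto lam atTop atTop ∧
      ∀ t < (0 : ℝ), ∀ x, Tendsto (fun j => lam j • W (lam j ^ 2 * t) (xs j + lam j • x)) atTop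
        (𝓝 (W' t x)) with hBD
  -- (1) sequential compactness of `E` (KNSS, fields AND gradients) with the constraints preserved
  have hextract : ∀ Wi : ℕ → ℝ → EuclideanSpace ℝ (Fin 3) → EuclideanSpace ℝ (Fin 3), (∀ i, Wi i ∈ E) →
      ∃ φ : ℕ → ℕ, StrictMono φ ∧ ∃ V ∈ E,
        ∀ t < (0 : ℝ), ∀ x, Tendsto (fun i => Wi (φ i) t x) atTop (𝓝 (V t x)) := by
    intro Wi hWi
    obtain ⟨φ, hφ, V, hV, hpt, hDpt, -, -⟩ := exists_tendsto_of_isTypeIAncientMild_seq C (fun i => (hWi i).1)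
    refine ⟨φ, hφ, V, ⟨hV, fun s hs y => poloidal_of_tendsto (hDpt s hs y) fun j => (hWi (φ j)).2.1 s hs y,
      fun s hs y => frozen_of_tendsto (hDpt s hs y) fun j => (hWi (φ j)).2.2.1 s hs y, ?_⟩, hpt⟩
    have h1 := (hpt (-1) (by norm_num) 0).norm
    have h2 : Tendsto (fun i => ‖Wi (φ i) (-1) 0‖) atTop (𝓝 C) := by
      have e : (fun i => ‖Wi (φ i) (-1) 0‖) = fun _ => C := funext fun i => (hWi (φ i)).2.2.2
      rw [e]
      exact tendsto_const_nhds
    exact tendsto_nhds_unique h1 h2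
  -- (2) pointwise convergence on the slab gives convergence of the evaluations
  have hιtend : ∀ (Wi : ℕ → ℝ → EuclideanSpace ℝ (Fin 3) → EuclideanSpace ℝ (Fin 3))
      (V : ℝ → EuclideanSpace ℝ (Fin 3) → EuclideanSpace ℝ (Fin 3)),
      (∀ t < (0 : ℝ), ∀ x, Tendsto (fun i => Wi i t x) atTop (𝓝 (V t x))) →
      Tendsto (fun i => ι (Wi i)) atTop (𝓝 (ι V)) := fun Wi V h =>
    tendsto_pi_nhds.2 fun n => h (q n).1 (hq n) (q n).2
  -- (3) `S` is compact
  have hSseq : IsSeqCompact S := by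
    intro y hy
    choose Wi hWiE hWiy using hy
    obtain ⟨φ, hφ, V, hVE, hpt⟩ := hextract Wi hWiE
    refine ⟨ι V, ⟨V, hVE, rfl⟩, φ, hφ, ?_⟩
    have h := hιtend (fun i => Wi (φ i)) V hpt
    have e : (fun i => ι (Wi (φ i))) = y ∘ φ := funext fun i => hWiy (φ i)
    rwa [e] at h
  have hScpt : IsCompact S := hSseq.isCompact
  -- (4) the admissible family: nonempty closed subsets of `S` invariant under blow-downs
  set A : Set (Set (ℕ → EuclideanSpace ℝ (Fin 3))) :=
    {F | F ⊆ S ∧ F.Nonempty ∧ IsClosed F ∧ ∀ W ∈ E, ι W ∈ F → ∀ W' ∈ E, BD W W' → ι W' ∈ F} with hA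
  obtain ⟨W₀, hW₀⟩ := hne
  have hW₀E : W₀ ∈ E := hW₀
  have hSA : S ∈ A :=
    ⟨subset_rfl, ⟨ι W₀, W₀, hW₀E, rfl⟩, hScpt.isClosed, fun W _ _ W' hW' _ => ⟨W', hW', rfl⟩⟩
  have hchain : ∀ c ⊆ A, IsChain (· ⊆ ·) c → ∃ lb ∈ A, ∀ s ∈ c, lb ⊆ s := by
    intro c hcA hc
    rcases c.eq_empty_or_nonempty with rfl | hcne
    · exact ⟨S, hSA, by simp⟩
    refine ⟨⋂₀ c, ⟨?_, ?_, ?_, ?_⟩, fun s hs => sInter_subset_of_mem hs⟩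
    · obtain ⟨s, hs⟩ := hcne
      exact (sInter_subset_of_mem hs).trans (hcA hs).1
    · haveI : Nonempty c := hcne.to_subtype
      have hdir : DirectedOn (· ⊇ ·) c := by
        intro a ha b hb
        rcases hc.total ha hb with hab | hba
        · exact ⟨a, ha, subset_rfl, hab⟩
        · exact ⟨b, hb, hba, subset_rfl⟩
      exact IsCompact.nonempty_sInter_of_directed_nonempty_isCompact_isClosed hdir
        (fun s hs => (hcA hs).2.1) (fun s hs => hScpt.of_isClosed_subset (hcA hs).2.2.1 (hcA hs).1)
        (fun s hs => (hcA hs).2.2.1)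
    · exact isClosed_sInter fun s hs => (hcA hs).2.2.1
    · intro W hW hWF W' hW' hbd'
      rw [mem_sInter] at hWF ⊢
      exact fun s hs => (hcA hs).2.2.2 W hW (hWF s hs) W' hW' hbd'
  -- (5) a minimal admissible set
  obtain ⟨F, hFmin⟩ := zorn_superset A hchain
  have hF : F ∈ A := hFmin.prop
  obtain ⟨y, hy⟩ := hF.2.1
  obtain ⟨W, hWE, hWy⟩ := hF.1 hy
  -- the blow-downs of `W` inside `E`
  set G : Set (ℕ → EuclideanSpace ℝ (Fin 3)) := ι '' {W' | W' ∈ E ∧ BD W W'} with hG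
  have hGF : G ⊆ F := by
    rintro _ ⟨W', ⟨hW'E, hbd'⟩, rfl⟩
    exact hF.2.2.2 W hWE (hWy ▸ hy) W' hW'E hbd'
  have hGne : G.Nonempty := by
    obtain ⟨W', hW'A, hW'p, hW'f, hW'n, hbd'⟩ := hbd W hWE.1 hWE.2.1 hWE.2.2.1 hWE.2.2.2
    exact ⟨ι W', W', ⟨⟨hW'A, hW'p, hW'f, hW'n⟩, hbd'⟩, rfl⟩
  have hGclosed : IsClosed G := by
    refine IsSeqClosed.isClosed fun z p hz hzp => ?_
    choose Wi hWi hWiz using hz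
    obtain ⟨φ, hφ, V, hVE, hpt⟩ := hextract Wi (fun i => (hWi i).1)
    have hιV : Tendsto (fun i => ι (Wi (φ i))) atTop (𝓝 (ι V)) := hιtend _ _ hpt
    have hzφ : Tendsto (fun i => z (φ i)) atTop (𝓝 p) := hzp.comp hφ.tendsto_atTop
    have e : (fun i => ι (Wi (φ i))) = fun i => z (φ i) := funext fun i => hWiz (φ i)
    rw [e] at hιV
    have hp : p = ι V := tendsto_nhds_unique hzφ hιV
    refine ⟨V, ⟨hVE, ?_⟩, hp.symm⟩
    exact blowDown_of_tendsto hWE.1 (W' := fun i => Wi (φ i)) (fun i => (hWi (φ i)).2) hVE.1 hpt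
  have hGinv : ∀ W₁ ∈ E, ι W₁ ∈ G → ∀ W₂ ∈ E, BD W₁ W₂ → ι W₂ ∈ G := by
    rintro W₁ hW₁ ⟨W₃, ⟨hW₃E, hbd₃⟩, hW₃₁⟩ W₂ hW₂ hbd₁₂
    have heq : ∀ t < (0 : ℝ), ∀ x, W₃ t x = W₁ t x :=
      eqOn_slab_of_eq_on_dense_seq hq hqd hW₃E.1 hW₁.1 (fun n => congr_fun hW₃₁ n)
    have hbdW₁ : BD W W₁ := by
      obtain ⟨lam, xs, hp, ht, hc⟩ := hbd₃
      exact ⟨lam, xs, hp, ht, fun t ht' x => (heq t ht' x) ▸ hc t ht' x⟩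
    exact ⟨W₂, ⟨hW₂, blowDown_trans hWE.1 hW₂.1 hbdW₁ hbd₁₂⟩, rfl⟩
  have hGA : G ∈ A := ⟨hGF.trans hF.1, hGne, hGclosed, hGinv⟩
  have hGeq : G = F := Subset.antisymm hGF (hFmin.2 hGA hGF)
  -- hence `ι W ∈ G`: some blow-down of `W` takes the values of `W` on `q`, so equals `W` on the slab
  have hWG : ι W ∈ G := by rw [hGeq, hWy]; exact hy
  obtain ⟨W', ⟨hW'E, hbdW'⟩, hW'W⟩ := hWG
  have heq' : ∀ t < (0 : ℝ), ∀ x, W' t x = W t x :=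
    eqOn_slab_of_eq_on_dense_seq hq hqd hW'E.1 hWE.1 (fun n => congr_fun hW'W n)
  obtain ⟨lam, xs, hp, ht, hc⟩ := hbdW'
  exact ⟨W, hWE.1, hWE.2.1, hWE.2.2.1, hWE.2.2.2, lam, xs, hp, ht, fun t ht' x => (heq' t ht' x) ▸ hc t ht' x⟩

end Summit.NavierStokesRegularity.NavierStokesRegularity.Theorems.PoloidalWindowDoorPoloidalWindowRigidityPoloidalExtremalRecurrent
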